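import Summits.CriticalPhenomena.PercolationContinuityZ3.Theorems.PercNearOneGluingNoHeavyQuantIndepBlobUnitCreditPair
import HarnessLib

/-!
# QUANT lane R8, T-DIB: the chord cells of the two-light certificate with the upper chord end above the heavy-free level
# (`n₂ = A ≥ j+1`: cells C1–C4 of P1-SURPLUS §23.5) — four explicit real inequalities

builds on p205010 (kernel theorem, internal audit signed; external expert review pending)

Support file (`--supports stmt-CriticalPhenomena-4575`), QUANT lane seat prim-quant-p1 (gen 12); memo
`run/shared/lean/prim/quant/P1-SURPLUS.md` §23.5–23.8.  Theorems only (statements about real numbers); no definitions, no sorries,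
standard axioms.  Companion of `…QuantIndepBlobTwoLightCells` (cells C5–C7, upper end `n₂ ≤ j`).

SETTING as there: floor `1/2 < x < 1`; lights `(B, G = x² + (1−x)a)` and `(b, g = x² + (1−x)c)`, `0 ≤ b ≤ B ≤ j`, `a, c ∈ [0, x)`,
`K = B a + b c`; heavy side of total size `A ≤ 2j` and mean `m` with `x A ≤ m` and `2j < m + K`; chord `(n₁, n₂)` with `n₂ = A`
(the worst upper end when the upper level `j + 1 − n₂ ≤ 0` has `F = 1`; the reduction `n₂ ↦ A` is done in the assembly) and
`0 ≤ n₁ < m < A`.  Writing `r = A − m` (the mean CLOSED heavy mass), the chord inequality is `r·(1 − F(j+1−n₁)) ≤ (1−x)(A − n₁)`,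
and `r ≤ (1−x)A` (floor), `r < A − 2j + K` (credit), `r < A − n₁`.

* `Quant.IndepBlob.twoLight_cellC4` — `F(j+1−n₁) = P₁ = 1 − (1−G)(1−g)` (`n₁ ≤ j`): either `(1−G)(1−g) ≤ 1−x` (then `r < A − n₁`
  suffices) or `a + c < 1/4`, `K < j/4`, `r < A − 7j/4` and `(A − 7j/4)(1−x)(1+x)² ≤ A − j`.
* `Quant.IndepBlob.twoLight_cellC3` — `F = G` (`n₁ ≤ j − b`): the credit gives `b c > r + 2j − A − B a`, hence
  `x(j − n₁) > r + 2j − A − B a`, and then `r(x² + x − 1 − x a) + B a ≤ j − (A − j)(1−x)`.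
* `Quant.IndepBlob.twoLight_cellC2` — `F = Gg` (`n₁ ≤ j − B`): `K ≤ (j − n₁)(a + c)` gives `(j − n₁)(a+c) > r + 2j − A`; with
  `1 − Gg ≤ 1 − x⁴ − x²(1−x)(a+c)` the claim reduces to two polynomial facts in `(x, σ = a + c)` (`twoLight_polyC2a/b`).
* `Quant.IndepBlob.twoLight_cellC1` — `F = 0` (`n₁ ≤ j − B − b`), the only cell that needs the non-mergeability `G·A < j`, `g·A < j`:
  for `xA ≤ j`, `m > 2j − x(j − n₁) ≥ xA + (1−x)n₁`; for `xA > j`, `K < (j − n₁)(j/A − x²)/(1−x)` and a concave quadratic in `A`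
  on `[j/x, 2j]`.
Numerics (`prim-quant-p1-g12/evidence/num/e16*.py`, `e17*.py`): exact margins `≥ 0.27` (C2), `0.43` (C3), `0.50` (C4), `0.51` (C1, under
the non-mergeability), `3–6·10⁶` samples, `j ≤ 80`.  [cite: KozmaNitzan2024, Conjecture 3 (p. 15)] (the gluing rows served); [this work].
-/

namespace Summit.CriticalPhenomena.PercolationContinuityZ3.Theorems

namespace Quant

namespace IndepBlob

/-! ### Cell C4 -/

/-- The closure-product bound used in cell C4: if `a + c ≥ 1/4` (`a, c ≤ x`, `1/2 ≤ x ≤ 1`) then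
`(1−x)²(1+x−a)(1+x−c) ≤ 1 − x`. [this work] -/
theorem twoLight_closure_quarter (x a c : ℝ) (hx : 1 / 2 ≤ x) (hx1 : x ≤ 1) (hax : a ≤ x) (hcx : c ≤ x)
    (h' : 1 / 4 ≤ a + c) : (1 - x) * ((1 - x) * ((1 + x - a) * (1 + x - c))) ≤ 1 - x := by
  have hε : 0 ≤ 1 - x := by linarith
  have hAM1 : (1 + x - a) * (1 + x - c) ≤ ((2 + 2 * x - (a + c)) / 2) ^ 2 := by
    have e : ((2 + 2 * x - (a + c)) / 2) ^ 2 - (1 + x - a) * (1 + x - c) = ((c - a) / 2) ^ 2 := by ring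
    nlinarith [e, sq_nonneg ((c - a) / 2)]
  have hs0 : 0 ≤ (2 + 2 * x - (a + c)) / 2 := by linarith
  have hs1 : (2 + 2 * x - (a + c)) / 2 ≤ (7 / 4 + 2 * x) / 2 := by linarith
  have hAM2 : ((2 + 2 * x - (a + c)) / 2) ^ 2 ≤ ((7 / 4 + 2 * x) / 2) ^ 2 := pow_le_pow_left₀ hs0 hs1 2
  have hpoly : (1 - x) * (7 / 4 + 2 * x) ^ 2 ≤ 4 := by nlinarith [sq_nonneg (x - 1 / 2)]
  have h3 : (1 - x) * ((1 + x - a) * (1 + x - c)) ≤ (1 - x) * (((7 / 4 + 2 * x) / 2) ^ 2) :=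
    mul_le_mul_of_nonneg_left (hAM1.trans hAM2) hε
  have h4 : (1 - x) * (((7 / 4 + 2 * x) / 2) ^ 2) ≤ 1 := by nlinarith [hpoly]
  have h5 := mul_le_mul_of_nonneg_left (h3.trans h4) hε
  linarith

/-- The arithmetic of cell C4 in the branch `(1−G)(1−g) > 1 − x` (then `a + c < 1/4`, `K < j/4`, `m > 7j/4`). [this work] -/
theorem twoLight_cellC4_aux (x a c j n₁ A m : ℝ) (hx : 1 / 2 < x) (hx1 : x < 1) (ha0 : 0 ≤ a) (hax : a ≤ x)
    (hc0 : 0 ≤ c) (hcx : c ≤ x) (hmA : m ≤ A) (hn1j : n₁ ≤ j) (hA2j : A ≤ 2 * j) (hm : 7 / 4 * j < m) :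
    (A - m) * ((1 - x) * (1 + x - a) * ((1 - x) * (1 + x - c))) ≤ (1 - x) * (A - n₁) := by
  have hε : 0 < 1 - x := by linarith
  have hr0 : 0 ≤ A - m := by linarith
  have hqq : (1 - x) * (1 + x - a) * ((1 - x) * (1 + x - c)) ≤ (1 - x) ^ 2 * (1 + x) ^ 2 := by
    have h1 : (1 + x - a) ≤ 1 + x := by linarith
    have h2 : (1 + x - c) ≤ 1 + x := by linarith
    have h3 := mul_le_mul h1 h2 (by linarith) (by linarith)
    have e : (1 - x) * (1 + x - a) * ((1 - x) * (1 + x - c)) = (1 - x) ^ 2 * ((1 + x - a) * (1 + x - c)) := by ring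
    rw [e]
    exact mul_le_mul_of_nonneg_left (by nlinarith [h3]) (sq_nonneg _)
  have hq0 : 0 ≤ (1 - x) * (1 + x - a) * ((1 - x) * (1 + x - c)) :=
    mul_nonneg (mul_nonneg hε.le (by linarith)) (mul_nonneg hε.le (by linarith))
  have h98 : (1 - x) * (1 + x) ^ 2 ≤ 9 / 8 := by nlinarith [sq_nonneg (x - 1 / 2), sq_nonneg x]
  have hpos : 0 < A - 7 / 4 * j := by linarith
  have hstep : (A - 7 / 4 * j) * ((1 - x) * (1 + x) ^ 2) ≤ A - j := by nlinarith
  have h1 : (A - m) * ((1 - x) * (1 + x - a) * ((1 - x) * (1 + x - c))) ≤ (A - 7 / 4 * j) * ((1 - x) ^ 2 * (1 + x) ^ 2) :=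
    mul_le_mul (by linarith) hqq hq0 hpos.le
  have h2 : (A - 7 / 4 * j) * ((1 - x) ^ 2 * (1 + x) ^ 2) = (1 - x) * ((A - 7 / 4 * j) * ((1 - x) * (1 + x) ^ 2)) := by
    ring
  have h3 : (1 - x) * ((A - 7 / 4 * j) * ((1 - x) * (1 + x) ^ 2)) ≤ (1 - x) * (A - j) :=
    mul_le_mul_of_nonneg_left hstep hε.le
  have h4 : (1 - x) * (A - j) ≤ (1 - x) * (A - n₁) := mul_le_mul_of_nonneg_left (by linarith) hε.le
  linarith [h1, h2, h3, h4]

/-- **Cell C4** (`F(n₁) = 1 − (1−G)(1−g)`, `F(A) = 1`). [this work] -/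
theorem twoLight_cellC4 (x a c G g B b j n₁ A m : ℝ) (hx : 1 / 2 < x) (hx1 : x < 1)
    (ha0 : 0 ≤ a) (hax : a ≤ x) (hc0 : 0 ≤ c) (hcx : c ≤ x) (hG : G = x ^ 2 + (1 - x) * a) (hg : g = x ^ 2 + (1 - x) * c)
    (hb0 : 0 ≤ b) (hbj : b ≤ j) (hBj : B ≤ j) (hn1m : n₁ < m) (hmA : m ≤ A) (hn1j : n₁ ≤ j) (hA2j : A ≤ 2 * j)
    (hcr : 2 * j < m + (B * a + b * c)) :
    x * (A - n₁) ≤ (A - m) * (1 - (1 - G) * (1 - g)) + (m - n₁) * 1 := by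
  have hε : 0 < 1 - x := by linarith
  have hqG : 1 - G = (1 - x) * (1 + x - a) := by rw [hG]; ring
  have hqg : 1 - g = (1 - x) * (1 + x - c) := by rw [hg]; ring
  -- the claim is `r·qGqg ≤ ε (A − n₁)`, `r = A − m`
  have hid : (A - m) * (1 - (1 - G) * (1 - g)) + (m - n₁) * 1 - x * (A - n₁) =
      (1 - x) * (A - n₁) - (A - m) * ((1 - G) * (1 - g)) := by ring
  have hr0 : 0 ≤ A - m := by linarith
  by_cases hq : (1 - G) * (1 - g) ≤ 1 - x
  · -- `r < A − n₁`
    have h1 : (A - m) * ((1 - G) * (1 - g)) ≤ (A - m) * (1 - x) := mul_le_mul_of_nonneg_left hq hr0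
    have h2 : (A - m) * (1 - x) ≤ (A - n₁) * (1 - x) := mul_le_mul_of_nonneg_right (by linarith) hε.le
    linarith [h1, h2, hid]
  · have hq' : 1 - x < (1 - G) * (1 - g) := not_le.mp hq
    -- `σ = a + c < 1/4`
    have hσ : a + c < 1 / 4 := by
      by_contra h
      have := twoLight_closure_quarter x a c hx.le hx1.le hax hcx (not_lt.mp h)
      rw [hqG, hqg] at hq'
      linarith
    -- `K < j/4`, so `m > 7j/4`
    have hK : B * a + b * c ≤ j * (a + c) := by
      have e1 := mul_le_mul_of_nonneg_right hBj ha0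
      have e2 := mul_le_mul_of_nonneg_right hbj hc0
      linarith
    have hj : 0 ≤ j := le_trans hb0 hbj
    have hjσ : j * (a + c) ≤ j * (1 / 4) := mul_le_mul_of_nonneg_left hσ.le hj
    have hm : 7 / 4 * j < m := by linarith
    have haux := twoLight_cellC4_aux x a c j n₁ A m hx hx1 ha0 hax hc0 hcx hmA hn1j hA2j hm
    rw [hqG, hqg] at hid ⊢
    linarith [hid, haux]

/-! ### Cell C3 -/

/-- The final inequality of cell C3: for `1/2 < x < 1`, `0 ≤ a ≤ x`, `B ≤ j`, `0 ≤ r ≤ (1−x)A`, `j ≤ A ≤ 2j`: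
`r(x² + x − 1 − x a) + B a ≤ j − (A − j)(1 − x)`. [this work] -/
theorem twoLight_finC3 (x a B j A r : ℝ) (hx : 1 / 2 < x) (hx1 : x < 1) (ha0 : 0 ≤ a) (hax : a ≤ x) (hBj : B ≤ j)
    (hr0 : 0 ≤ r) (hrε : r ≤ (1 - x) * A) (hjA : j ≤ A) (hA2j : A ≤ 2 * j) :
    r * (x ^ 2 + x - 1 - x * a) + B * a ≤ j - (A - j) * (1 - x) := by
  have hε : 0 < 1 - x := by linarith
  have hx0 : 0 < x := by linarith
  have h1 : r * (x ^ 2 + x - 1 - x * a) + B * a = r * (x ^ 2 + x - 1) + a * (B - r * x) := by ring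
  by_cases hB : r * x ≤ B
  · -- increasing in `a`: bound at `a = x`
    have h2 : a * (B - r * x) ≤ x * (B - r * x) := mul_le_mul_of_nonneg_right hax (by linarith)
    have h3 : r * (x ^ 2 + x - 1) + x * (B - r * x) = x * B - (1 - x) * r := by ring
    have h4 : x * B ≤ x * j := mul_le_mul_of_nonneg_left hBj hx0.le
    have h5 : (A - j) * (1 - x) ≤ j * (1 - x) := mul_le_mul_of_nonneg_right (by linarith) hε.le
    nlinarith [h1, h2, h3, h4, h5, mul_nonneg hε.le hr0]
  · have hB' : B < r * x := not_le.mp hB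
    -- decreasing in `a`: bound at `a = 0`
    have h2 : a * (B - r * x) ≤ 0 := mul_nonpos_of_nonneg_of_nonpos ha0 (by linarith)
    by_cases hsgn : x ^ 2 + x - 1 ≤ 0
    · have h3 : r * (x ^ 2 + x - 1) ≤ 0 := mul_nonpos_of_nonneg_of_nonpos hr0 hsgn
      have h5 : (A - j) * (1 - x) ≤ j * (1 - x) := mul_le_mul_of_nonneg_right (by linarith) hε.le
      nlinarith [h1, h2, h3, h5]
    · have hsgn' : 0 < x ^ 2 + x - 1 := not_le.mp hsgn
      have h3 : r * (x ^ 2 + x - 1) ≤ (1 - x) * A * (x ^ 2 + x - 1) := mul_le_mul_of_nonneg_right hrε hsgn'.le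
      have hp : (1 - x) * (2 * x ^ 2 + 2 * x - 1) ≤ 1 := by nlinarith [sq_nonneg (x - 1 / 2), sq_nonneg (x - 1)]
      have hj0 : 0 ≤ j := by linarith
      have h4 : A * (x ^ 2 + x) ≤ 2 * j * (x ^ 2 + x) := mul_le_mul_of_nonneg_right hA2j (by nlinarith)
      have h5 : (1 - x) * (A * (x ^ 2 + x) - j) ≤ (1 - x) * (2 * j * (x ^ 2 + x) - j) :=
        mul_le_mul_of_nonneg_left (by linarith) hε.le
      have h6 : j * ((1 - x) * (2 * x ^ 2 + 2 * x - 1)) ≤ j * 1 := mul_le_mul_of_nonneg_left hp hj0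
      have e4 : (1 - x) * A * (x ^ 2 + x - 1) + (A - j) * (1 - x) = (1 - x) * (A * (x ^ 2 + x) - j) := by ring
      have e5 : (1 - x) * (2 * j * (x ^ 2 + x) - j) = j * ((1 - x) * (2 * x ^ 2 + 2 * x - 1)) := by ring
      linarith [h1, h2, h3, h4, h5, h6, e4, e5]

/-- **Cell C3** (`F(n₁) = G`, `F(A) = 1`; cell `n₁ ≤ j − b`). [this work] -/
theorem twoLight_cellC3 (x a c G B b j n₁ A m : ℝ) (hx : 1 / 2 < x) (hx1 : x < 1)
    (ha0 : 0 ≤ a) (hax : a ≤ x) (hcx : c ≤ x) (hG : G = x ^ 2 + (1 - x) * a)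
    (hb0 : 0 ≤ b) (hBj : B ≤ j) (hmA : x * A ≤ m) (hmA' : m ≤ A) (hjA : j ≤ A) (hA2j : A ≤ 2 * j)
    (hcell : n₁ ≤ j - b) (hcr : 2 * j < m + (B * a + b * c)) :
    x * (A - n₁) ≤ (A - m) * G + (m - n₁) * 1 := by
  have hε : 0 < 1 - x := by linarith
  have hx0 : 0 < x := by linarith
  have hr0 : 0 ≤ A - m := by linarith
  have hrε : A - m ≤ (1 - x) * A := by linarith
  -- credit: `b c > r + 2j − A − B a`, and `b c ≤ b x ≤ (j − n₁) x`
  have hbc : b * c ≤ (j - n₁) * x := by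
    have e1 : b * c ≤ b * x := mul_le_mul_of_nonneg_left hcx hb0
    have e2 : b * x ≤ (j - n₁) * x := mul_le_mul_of_nonneg_right (by linarith) hx0.le
    linarith
  have hu : (A - m) + 2 * j - A - B * a < (j - n₁) * x := by linarith
  have hid : (A - m) * G + (m - n₁) * 1 - x * (A - n₁) = (1 - x) * (A - n₁) - (A - m) * (1 - G) := by ring
  have hqG : 1 - G = (1 - x) * (1 + x - a) := by rw [hG]; ring
  have hfin := twoLight_finC3 x a B j A (A - m) hx hx1 ha0 hax hBj hr0 hrε hjA hA2j
  -- `x·r(1−G) ≤ ε(x(A−j) + r + 2j − A − Ba)`: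
  have hmain : x * ((A - m) * (1 - G)) ≤ (1 - x) * (x * (A - j) + (A - m) + 2 * j - A - B * a) := by
    rw [hqG]
    have e : (1 - x) * (x * (A - j) + (A - m) + 2 * j - A - B * a) - x * ((A - m) * ((1 - x) * (1 + x - a))) =
        (1 - x) * (j - (A - j) * (1 - x) - ((A - m) * (x ^ 2 + x - 1 - x * a) + B * a)) := by ring
    have h2 := mul_nonneg hε.le (sub_nonneg.2 hfin)
    linarith [e, h2]
  have h2 : (1 - x) * (x * (A - j) + (A - m) + 2 * j - A - B * a) ≤ (1 - x) * (x * (A - n₁)) := by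
    have e : x * (A - n₁) = x * (A - j) + (j - n₁) * x := by ring
    rw [e]
    exact mul_le_mul_of_nonneg_left (by linarith) hε.le
  have h3 : x * ((A - m) * (1 - G)) ≤ x * ((1 - x) * (A - n₁)) := by linarith [hmain, h2]
  have h4 : (A - m) * (1 - G) ≤ (1 - x) * (A - n₁) := le_of_mul_le_mul_left h3 hx0
  linarith [hid, h4]

/-! ### Cell C2 -/

/-- Polynomial fact for cell C2: `σ − 2ψ(σ) ≥ 0`, `ψ(σ) = σ(1 − x⁴) − x²(1−x)σ² − (1−x)`, for `σ ∈ [0, 2x]`. [this work] -/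
theorem twoLight_polyC2a (x σ : ℝ) (hx : 1 / 2 ≤ x) (hx1 : x ≤ 1) (hσ0 : 0 ≤ σ) (hσ : σ ≤ 2 * x) :
    0 ≤ 2 * x ^ 2 * (1 - x) * σ ^ 2 + (2 * x ^ 4 - 1) * σ + 2 * (1 - x) := by
  have hσx : 0 ≤ σ * (2 * x - σ) := mul_nonneg hσ0 (by linarith)
  nlinarith [hσx, mul_nonneg (sub_nonneg.2 hx) (sub_nonneg.2 hx1), sq_nonneg (σ - 1),
    mul_nonneg hσx (sub_nonneg.2 hx1), sq_nonneg (x - 1 / 2), sq_nonneg (x ^ 2 - 1 / 2),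
    mul_nonneg (sq_nonneg (σ - 1)) (sub_nonneg.2 hx), mul_nonneg (sq_nonneg (σ * x - 1)) (sub_nonneg.2 hx1),
    mul_nonneg hσ0 (sub_nonneg.2 hx1), mul_nonneg (mul_nonneg hσ0 (sub_nonneg.2 hx1)) (sub_nonneg.2 hx)]

/-- Polynomial fact for cell C2: `1 − ψ(σ) ≥ 0` for `σ ∈ [0, 2x]`. [this work] -/
theorem twoLight_polyC2b (x σ : ℝ) (hx : 1 / 2 ≤ x) (hx1 : x ≤ 1) (hσ0 : 0 ≤ σ) (hσ : σ ≤ 2 * x) :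
    0 ≤ 1 + (1 - x) - σ * (1 - x ^ 4) + x ^ 2 * (1 - x) * σ ^ 2 := by
  nlinarith [mul_nonneg hσ0 (sub_nonneg.2 hσ), mul_nonneg (sub_nonneg.2 hx) (sub_nonneg.2 hx1), sq_nonneg (σ - 1),
    mul_nonneg (mul_nonneg hσ0 (sub_nonneg.2 hσ)) (sub_nonneg.2 hx1), sq_nonneg (x - 1 / 2),
    mul_nonneg hσ0 (sub_nonneg.2 hx1), mul_nonneg (mul_nonneg hσ0 (sub_nonneg.2 hx1)) (sub_nonneg.2 hx),
    mul_nonneg (sub_nonneg.2 hσ) (sub_nonneg.2 hx1), sq_nonneg (x - 1), mul_nonneg (sq_nonneg (x-1)) hσ0]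

/-- The main inequality of cell C2: with `ψ(σ) = σ(1−x⁴) − x²(1−x)σ² − (1−x)`, `0 ≤ r ≤ (1−x)(j+k)`, `0 ≤ k ≤ j`,
`σ ∈ [0, 2x]`: `r·σ·(1 − x⁴ − x²(1−x)σ) ≤ (1−x)(kσ + r + j − k)`. [this work] -/
theorem twoLight_mainC2 (x σ r k j : ℝ) (hx : 1 / 2 < x) (hx1 : x < 1) (hσ0 : 0 ≤ σ) (hσ2 : σ ≤ 2 * x)
    (hr0 : 0 ≤ r) (hr : r ≤ (1 - x) * (j + k)) (hk0 : 0 ≤ k) (hkj : k ≤ j) :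
    r * σ * (1 - x ^ 4 - x ^ 2 * (1 - x) * σ) ≤ (1 - x) * (k * σ + r + j - k) := by
  have hε : 0 < 1 - x := by linarith
  have hP1 := twoLight_polyC2a x σ hx.le hx1.le hσ0 hσ2
  have hP2 := twoLight_polyC2b x σ hx.le hx1.le hσ0 hσ2
  -- `r σ (1 − x⁴ − x²εσ) = r ψ + r ε`
  have e : r * σ * (1 - x ^ 4 - x ^ 2 * (1 - x) * σ) =
      r * (σ * (1 - x ^ 4) - x ^ 2 * (1 - x) * σ ^ 2 - (1 - x)) + r * (1 - x) := by ring
  rw [e]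
  by_cases hψ : σ * (1 - x ^ 4) - x ^ 2 * (1 - x) * σ ^ 2 - (1 - x) ≤ 0
  · have h2 : r * (σ * (1 - x ^ 4) - x ^ 2 * (1 - x) * σ ^ 2 - (1 - x)) ≤ 0 := mul_nonpos_of_nonneg_of_nonpos hr0 hψ
    nlinarith [h2, mul_nonneg hk0 hσ0, mul_nonneg hε.le (sub_nonneg.2 hkj), mul_nonneg hε.le (mul_nonneg hk0 hσ0)]
  · have hψ' : 0 < σ * (1 - x ^ 4) - x ^ 2 * (1 - x) * σ ^ 2 - (1 - x) := not_le.mp hψ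
    have h2 : r * (σ * (1 - x ^ 4) - x ^ 2 * (1 - x) * σ ^ 2 - (1 - x)) ≤
        (1 - x) * (j + k) * (σ * (1 - x ^ 4) - x ^ 2 * (1 - x) * σ ^ 2 - (1 - x)) := mul_le_mul_of_nonneg_right hr hψ'.le
    -- `(j + k) ψ ≤ k σ + j − k` from `1 − ψ ≥ 0` (hP2), `σ − 2ψ ≥ 0` (hP1), `0 ≤ k ≤ j`:
    -- `j(1−ψ) + k(σ − 1 − ψ) ≥ k(1 − ψ) + k(σ − 1 − ψ) = k(σ − 2ψ) ≥ 0`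
    have hA : 0 ≤ (j - k) * (1 + (1 - x) - σ * (1 - x ^ 4) + x ^ 2 * (1 - x) * σ ^ 2) :=
      mul_nonneg (sub_nonneg.2 hkj) hP2
    have hB : 0 ≤ k * (2 * x ^ 2 * (1 - x) * σ ^ 2 + (2 * x ^ 4 - 1) * σ + 2 * (1 - x)) := mul_nonneg hk0 hP1
    have key : (j + k) * (σ * (1 - x ^ 4) - x ^ 2 * (1 - x) * σ ^ 2 - (1 - x)) ≤ k * σ + j - k := by
      nlinarith [hA, hB]
    have h3 := mul_le_mul_of_nonneg_left key hε.le
    nlinarith [h2, h3]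

/-- **Cell C2** (`F(n₁) = Gg`, `F(A) = 1`; cell `n₁ ≤ j − B`). [this work] -/
theorem twoLight_cellC2 (x a c G g B b j n₁ A m : ℝ) (hx : 1 / 2 < x) (hx1 : x < 1)
    (ha0 : 0 ≤ a) (hax : a ≤ x) (hc0 : 0 ≤ c) (hcx : c ≤ x) (hG : G = x ^ 2 + (1 - x) * a) (hg : g = x ^ 2 + (1 - x) * c)
    (hb0 : 0 ≤ b) (hbB : b ≤ B) (hmA : x * A ≤ m) (hmA' : m < A) (hjA : j ≤ A) (hA2j : A ≤ 2 * j)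
    (hcell : n₁ ≤ j - B) (hcr : 2 * j < m + (B * a + b * c)) :
    x * (A - n₁) ≤ (A - m) * (G * g) + (m - n₁) * 1 := by
  have hε : 0 < 1 - x := by linarith
  have hr0 : 0 < A - m := by linarith
  have hrε : A - m ≤ (1 - x) * A := by linarith
  have hσ0 : 0 ≤ a + c := by linarith
  have hσ2 : a + c ≤ 2 * x := by linarith
  -- `K ≤ u σ`, `u = j − n₁`
  have hK : B * a + b * c ≤ (j - n₁) * (a + c) := by
    have hB : B ≤ j - n₁ := by linarith
    have e1 := mul_le_mul_of_nonneg_right hB ha0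
    have e2 := mul_le_mul_of_nonneg_right (hbB.trans hB) hc0
    nlinarith [e1, e2]
  -- credit: `u σ > r + (2j − A)`
  have hu : (A - m) + (2 * j - A) < (j - n₁) * (a + c) := by linarith
  have hσpos : 0 < a + c := by
    by_contra h
    have h' : a + c ≤ 0 := not_lt.mp h
    have : (j - n₁) * (a + c) = 0 := by nlinarith
    nlinarith
  -- `1 − Gg ≤ 1 − x⁴ − x²(1−x)σ`
  have hGg : 1 - G * g ≤ 1 - x ^ 4 - x ^ 2 * (1 - x) * (a + c) := by
    rw [hG, hg]; nlinarith [mul_nonneg (mul_nonneg hε.le ha0) (mul_nonneg hε.le hc0)]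
  -- main inequality `r σ (1 − Gg) ≤ ε (k σ + r + j − k)`, `k = A − j`
  have hmain : (A - m) * (a + c) * (1 - G * g) ≤ (1 - x) * ((A - j) * (a + c) + (A - m) + j - (A - j)) := by
    have h1 : (A - m) * (a + c) * (1 - G * g) ≤ (A - m) * (a + c) * (1 - x ^ 4 - x ^ 2 * (1 - x) * (a + c)) :=
      mul_le_mul_of_nonneg_left hGg (mul_nonneg hr0.le hσ0)
    have h2 := twoLight_mainC2 x (a + c) (A - m) (A - j) j hx hx1 hσ0 hσ2 hr0.le (by linarith) (by linarith) (by linarith)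
    linarith [h1, h2]
  -- from `hmain` and `hu`: `r σ (1−Gg) < ε((A−j)σ + (j−n₁)σ) = ε σ (A − n₁)`, divide by `σ > 0`
  have h3 : (A - m) * (a + c) * (1 - G * g) < (1 - x) * ((a + c) * (A - n₁)) := by
    have := mul_lt_mul_of_pos_left hu hε
    nlinarith [hmain, this]
  have h4 : (A - m) * (1 - G * g) < (1 - x) * (A - n₁) := by
    have e : (A - m) * (a + c) * (1 - G * g) = (a + c) * ((A - m) * (1 - G * g)) := by ring
    have e' : (1 - x) * ((a + c) * (A - n₁)) = (a + c) * ((1 - x) * (A - n₁)) := by ring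
    rw [e, e'] at h3
    exact lt_of_mul_lt_mul_left h3 hσpos.le
  have hid : (A - m) * (G * g) + (m - n₁) * 1 - x * (A - n₁) = (1 - x) * (A - n₁) - (A - m) * (1 - G * g) := by ring
  linarith [hid, h4]

/-! ### Cell C1 -/

/-- The concave quadratic of cell C1: for `1/2 < x < 1`, `1 ≤ j`, `0 ≤ n₁ ≤ j`, `j ≤ x A`, `A ≤ 2j`:
`0 ≤ 2j(1−x)A − (j − n₁)(j − x²A) − (1−x)x A² − (1−x)² n₁ A` (nonnegative at `A = j/x` and `A = 2j`). [this work] -/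
theorem twoLight_polyC1 (x j n₁ A : ℝ) (hx : 1 / 2 < x) (hx1 : x < 1) (hj : 1 ≤ j) (hn10 : 0 ≤ n₁) (hn1j : n₁ ≤ j)
    (hreg : j ≤ x * A) (hA2j : A ≤ 2 * j) :
    0 ≤ 2 * j * (1 - x) * A - (j - n₁) * (j - x ^ 2 * A) - (1 - x) * x * A ^ 2 - (1 - x) ^ 2 * n₁ * A := by
  have hε : 0 < 1 - x := by linarith
  have t1 : 0 ≤ x * A - j := by linarith
  have t2 : 0 ≤ 2 * j - A := by linarith
  have hQ1 : 0 ≤ (1 - x) ^ 2 * j ^ 2 + (1 - x) * j * n₁ * (2 * x - 1) := by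
    have := mul_nonneg (mul_nonneg (mul_nonneg hε.le (le_trans zero_le_one hj)) hn10) (show 0 ≤ 2 * x - 1 by linarith)
    nlinarith [sq_nonneg ((1 - x) * j), this]
  have hQ2 : 0 ≤ j ^ 2 * (6 * x ^ 2 - 8 * x + 3) - n₁ * j * (2 * x - 1) ^ 2 := by
    have e : j ^ 2 * (6 * x ^ 2 - 8 * x + 3) - n₁ * j * (2 * x - 1) ^ 2 =
        j * (2 * j * (1 - x) ^ 2 + (j - n₁) * (2 * x - 1) ^ 2) := by ring
    rw [e]
    exact mul_nonneg (by linarith) (by nlinarith [sq_nonneg (1 - x), sq_nonneg (2 * x - 1), sub_nonneg.2 hn1j])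
  have e : j * (2 * x - 1) * (2 * j * (1 - x) * A - (j - n₁) * (j - x ^ 2 * A) - (1 - x) * x * A ^ 2 - (1 - x) ^ 2 * n₁ * A) =
      j * (2 * x - 1) * ((1 - x) * ((x * A - j) * (2 * j - A))) +
      (2 * j - A) * ((1 - x) ^ 2 * j ^ 2 + (1 - x) * j * n₁ * (2 * x - 1)) +
      (x * A - j) * (j ^ 2 * (6 * x ^ 2 - 8 * x + 3) - n₁ * j * (2 * x - 1) ^ 2) := by ring
  have s1 : 0 ≤ j * (2 * x - 1) * ((1 - x) * ((x * A - j) * (2 * j - A))) :=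
    mul_nonneg (mul_nonneg (by linarith) (by linarith)) (mul_nonneg hε.le (mul_nonneg t1 t2))
  have s2 : 0 ≤ (2 * j - A) * ((1 - x) ^ 2 * j ^ 2 + (1 - x) * j * n₁ * (2 * x - 1)) := mul_nonneg t2 hQ1
  have s3 : 0 ≤ (x * A - j) * (j ^ 2 * (6 * x ^ 2 - 8 * x + 3) - n₁ * j * (2 * x - 1) ^ 2) := mul_nonneg t1 hQ2
  have hprod : 0 ≤ j * (2 * x - 1) *
      (2 * j * (1 - x) * A - (j - n₁) * (j - x ^ 2 * A) - (1 - x) * x * A ^ 2 - (1 - x) ^ 2 * n₁ * A) := by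
    rw [e]; linarith
  have hjpos : 0 < j * (2 * x - 1) := mul_pos (by linarith) (by linarith)
  exact nonneg_of_mul_nonneg_right hprod hjpos

/-- **Cell C1** (`F(n₁) = 0`, `F(A) = 1`; cell `n₁ ≤ j − B − b`), under the non-mergeability `G·A < j`, `g·A < j`. [this work] -/
theorem twoLight_cellC1 (x a c G g B b j n₁ A m : ℝ) (hx : 1 / 2 < x) (hx1 : x < 1)
    (ha0 : 0 ≤ a) (hax : a ≤ x) (hcx : c ≤ x) (hG : G = x ^ 2 + (1 - x) * a) (hg : g = x ^ 2 + (1 - x) * c)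
    (hb0 : 0 ≤ b) (hB0 : 0 ≤ B) (hj : 1 ≤ j) (hn10 : 0 ≤ n₁) (hmA : x * A ≤ m) (hA2j : A ≤ 2 * j)
    (hcell : n₁ ≤ j - B - b) (hcr : 2 * j < m + (B * a + b * c)) (hGA : G * A < j) (hgA : g * A < j) :
    x * (A - n₁) ≤ (A - m) * 0 + (m - n₁) * 1 := by
  have hε : 0 < 1 - x := by linarith
  have hx0 : 0 < x := by linarith
  by_cases hreg : x * A ≤ j
  · -- `K ≤ x(B + b) ≤ x (j − n₁)` and `m > 2j − K`
    have e1 : B * a ≤ B * x := mul_le_mul_of_nonneg_left hax hB0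
    have e2 : b * c ≤ b * x := mul_le_mul_of_nonneg_left hcx hb0
    have e3 : (B + b) * x ≤ (j - n₁) * x := mul_le_mul_of_nonneg_right (by linarith) hx0.le
    nlinarith [e1, e2, e3]
  · have hreg' : j < x * A := not_le.mp hreg
    have hA0 : 0 < A := by nlinarith
    -- non-mergeability: `ε a A < j − x² A`, same for `c`
    have haA : (1 - x) * a * A < j - x ^ 2 * A := by
      have : G * A = x ^ 2 * A + (1 - x) * a * A := by rw [hG]; ring
      linarith
    have hcA : (1 - x) * c * A < j - x ^ 2 * A := by
      have : g * A = x ^ 2 * A + (1 - x) * c * A := by rw [hg]; ring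
      linarith
    have hjx : 0 ≤ j - x ^ 2 * A := by nlinarith [mul_nonneg (mul_nonneg hε.le ha0) hA0.le]
    -- `ε K A ≤ (B + b)(j − x² A) ≤ (j − n₁)(j − x²A)`
    have hKA : (1 - x) * (B * a + b * c) * A ≤ (j - n₁) * (j - x ^ 2 * A) := by
      have e1 : B * ((1 - x) * a * A) ≤ B * (j - x ^ 2 * A) := mul_le_mul_of_nonneg_left haA.le hB0
      have e2 : b * ((1 - x) * c * A) ≤ b * (j - x ^ 2 * A) := mul_le_mul_of_nonneg_left hcA.le hb0
      have e3 : (B + b) * (j - x ^ 2 * A) ≤ (j - n₁) * (j - x ^ 2 * A) := mul_le_mul_of_nonneg_right (by linarith) hjx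
      have e4 : (1 - x) * (B * a + b * c) * A = B * ((1 - x) * a * A) + b * ((1 - x) * c * A) := by ring
      linarith [e1, e2, e3, e4]
    have hQ := twoLight_polyC1 x j n₁ A hx hx1 hj hn10 (by linarith) hreg'.le hA2j
    -- `ε A (m + K) > 2 j ε A`, hence `ε m A > 2jεA − (j − n₁)(j − x²A)`; with `Q ≥ 0` this gives `m ≥ xA + ε n₁`
    have hm : (1 - x) * A * (2 * j) < (1 - x) * A * (m + (B * a + b * c)) := mul_lt_mul_of_pos_left hcr (mul_pos hε hA0)
    have hgoal : (1 - x) * A * (x * (A - n₁)) ≤ (1 - x) * A * (m - n₁) := by nlinarith [hm, hKA, hQ]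
    have h5 : 0 < (1 - x) * A := mul_pos hε hA0
    have := le_of_mul_le_mul_left hgoal h5
    linarith

end IndepBlob

end Quant

end Summit.CriticalPhenomena.PercolationContinuityZ3.Theorems
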